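/-
Copyright (c) 2026 the pub-hodgecm-mathlib formalisation cell (harness21).  Prover seat hodgecm-mathlib-F0P2-p08 (g3) (KW DESK OF RECORD; own pen announced 00:54:20Z):
Track B «K2-LIT», hLiu418 = stmt-HodgeConjecture-24832, residue #3 KIND-W (iii-arch) — the 26 by-value archimedean SIZE-FRAME letters of the KW head of record
(★ p863724 `kindW_block_cm_of_localLetters_haar` :163–169) AT THE FRAMES OF RECORD (★ arch₄'s closed forms).  THEOREMS ONLY.
-/
import Summits.HodgeConjecture.HodgeConjecture.Theorems.K2LiuKindWArchContinuationFramesOfRecord   -- ★ p863672: brings ★ arch₄ `exists_tubeFrame_arch₄`, ★ `tw_ne_zero`, the frame currency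
import HarnessLib

/-!
# Crux `HLiu418`, residue #3 KIND-W (iii-arch) — THE SIZE-FRAME LETTERS AT THE FRAMES OF RECORD

Cell `hodgecm-mathlib`, crux item hLiu418 = `stmt-HodgeConjecture-24832`; squad K2, KW desk F0P2-p08 (g3) own pen (announced 00:54:20Z).  Lane `--supports
stmt-HodgeConjecture-24832 --as helper` (count-neutral).  THEOREMS ONLY (no `def`, no instance, no notation, no named-fact hypothesis, no `sorry`).

THE POINT.  The KW head of record ★ `K2LiuKindWBlockOfRecordCMOfLocalLettersHaar.kindW_block_cm_of_localLetters_haar` takes, in its (iii-arch) block, 26 frame letters BY VALUE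
— an index-frame family `{Sinf} φ A B Ainv Binv` with a common entry bound `Mf` and one-sided inverses (`hMf hA hB hAe hBe hAi hBi`), a covering of the infinite places `hcover`,
complex places `w` fixed by complex conjugation `hw`, a reindexing `er`, archimedean frames `T Tinv` with `hT : T σ * Tinv σ = 1` and a common entry bound `M` (`hM hTe hTe'`) —
plus ONE analytic letter `hBL` («Φ6b-ind» growth) stated against them.  This file PAYS the 26 frame letters at the frames OF RECORD, the same closed-form Shimura frames
★ arch₄ `exists_tubeFrame_arch₄` that the (x-a) column uses (★ p863672 ∕ ★ p863767 `exists_frames_hex_of_std(')` export `hTdef hTinvdef`): the theorem takes `T Tinv` with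
their closed forms as INPUTS (so the tie feeds the frames it already `obtain`ed for `hex`) and returns
* `A σ := (-2 : ℂ) • (T σ).toBlocks₂₂`, `B σ := (Tinv σ).toBlocks₁₁` — so that `A σ * S^{φ σ} * B σ` is LITERALLY the framed index `HIDX S σ` of ★ p863743 ∕ ★ p863806 (K2Liu-p11):
  ONE index across the (x-a) and (iii-arch) columns — with explicit diagonal inverses `Ainv Binv`;
* at `Sinf := {w : InfinitePlace L // w.IsComplex}`, `φ σ := σ.1.embedding`, `w := id`, `er := e₂ (n := 2)`: `hcover` (a CM field is totally complex), `hw` (★ `complexConj_smul_infinitePlace`),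
  `hT` (★ arch₄), and ONE crude common bound `Mf = M := 1 + Σ_{σ,k} (2·a_{σk} + a_{σk}⁻¹)`, `a_{σk} = √(|re ι_σ(dV·dW)_k| ∕ 2) > 0` (★ `tw_ne_zero`), for every entry of `A B Ainv Binv T Tinv`.
After this file the (iii-arch) block of the tie is ONE by-value letter: `hBL`, to be stated by its payer against THESE frames.
HONEST LABEL.  Count-neutral helper; `hBL` («Φ6b-ind») remains a named input of the KIND-W block: `HC_CM` is proved only modulo the 7 printed citations (2 remaining named inputs:
hLiu418 = `stmt-HodgeConjecture-24832`, h413 = `stmt-HodgeConjecture-24833`) until rung 0 closes.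

## References
* [Shimura1997] G. Shimura, *Euler Products and Eisenstein Series*, CBMS 93 (1997), §16.4, §18.1 (18.4).
* [BorelJacquet1979] A. Borel, H. Jacquet, Proc. Symp. Pure Math. 33 (1979), §1.2, §4.1.
-/

set_option autoImplicit false
set_option linter.dupNamespace false -- the mandated namespace repeats `HodgeConjecture.HodgeConjecture`

noncomputable section

open Complex Matrix NumberField NumberField.InfinitePlace
open scoped ComplexConjugate Classical
open Literature.NumberTheory.Automorphic Literature.NumberTheory.Automorphic.UnitaryGroup
open Literature.NumberTheory.GelbartRogawski1991 Literature.NumberTheory.GelbartRogawski1991.GRConstruction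
open Literature.NumberTheory.GelbartRogawski1991.UnitaryDualPair
open Literature.NumberTheory.K2Lit.SiegelDoubled

namespace Summit.HodgeConjecture.HodgeConjecture.Cruxes.HLiu418.K2LiuKindWArchSizeFramesOfRecord

open K2LiuHermitianTubeFrameSign (exists_tubeFrame_arch₄)
open K2LiuHermitianTubeFrameArch (tw_ne_zero)

/-! ## §1 Entry bookkeeping: block-diagonal `2 ⊕ 2` matrices and the one crude bound `2a + a⁻¹` -/

/-- every entry of a diagonal `2 × 2` matrix is bounded by a common (nonnegative) bound of its diagonal. [folklore] -/
theorem norm_diagonal_apply_le {p : Fin 2 → ℂ} {C : ℝ} (hC : 0 ≤ C) (hp : ∀ k, ‖p k‖ ≤ C) (i j : Fin 2) :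
    ‖(diagonal p : Matrix (Fin 2) (Fin 2) ℂ) i j‖ ≤ C := by
  rw [diagonal_apply]
  split_ifs
  · exact hp i
  · simpa using hC

/-- every entry of a `2 ⊕ 2` block matrix with diagonal blocks is bounded by a common (nonnegative) bound of the four diagonals. [folklore] -/
theorem norm_fromBlocks_diagonal_apply_le {p q r s : Fin 2 → ℂ} {C : ℝ} (hC : 0 ≤ C)
    (hp : ∀ k, ‖p k‖ ≤ C) (hq : ∀ k, ‖q k‖ ≤ C) (hr : ∀ k, ‖r k‖ ≤ C) (hs : ∀ k, ‖s k‖ ≤ C) (i j : Fin 2 ⊕ Fin 2) :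
    ‖(fromBlocks (diagonal p) (diagonal q) (diagonal r) (diagonal s) : Matrix (Fin 2 ⊕ Fin 2) (Fin 2 ⊕ Fin 2) ℂ) i j‖ ≤ C := by
  rcases i with i | i <;> rcases j with j | j
  · rw [fromBlocks_apply₁₁]; exact norm_diagonal_apply_le hC hp i j
  · rw [fromBlocks_apply₁₂]; exact norm_diagonal_apply_le hC hq i j
  · rw [fromBlocks_apply₂₁]; exact norm_diagonal_apply_le hC hr i j
  · rw [fromBlocks_apply₂₂]; exact norm_diagonal_apply_le hC hs i j

/-- `‖(x : ℂ)‖ = |x|` turned into a bound. [folklore] -/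
theorem norm_ofReal_le_of_abs_le {x C : ℝ} (h : |x| ≤ C) : ‖((x : ℝ) : ℂ)‖ ≤ C := by
  rwa [Complex.norm_real, Real.norm_eq_abs]

/-- `‖I · (x : ℂ)‖ = |x|` turned into a bound. [folklore] -/
theorem norm_I_mul_ofReal_le_of_abs_le {x C : ℝ} (h : |x| ≤ C) : ‖I * ((x : ℝ) : ℂ)‖ ≤ C := by
  rwa [norm_mul, Complex.norm_I, one_mul, Complex.norm_real, Real.norm_eq_abs]

/-- the crude bound: `a ≤ 2a + a⁻¹` for `a > 0`. [folklore] -/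
theorem abs_le_crude {a : ℝ} (ha : 0 < a) : |a| ≤ 2 * a + a⁻¹ := by
  rw [abs_of_pos ha]; have := inv_pos.2 ha; linarith

/-- the crude bound: `|s·a| ≤ 2a + a⁻¹` for `a > 0`, `|s| = 1`. [folklore] -/
theorem abs_sign_mul_le_crude {a s : ℝ} (ha : 0 < a) (hs : |s| = 1) : |s * a| ≤ 2 * a + a⁻¹ := by
  rw [abs_mul, hs, one_mul]; exact abs_le_crude ha

/-- the crude bound: `a⁻¹∕2 ≤ 2a + a⁻¹` for `a > 0`. [folklore] -/
theorem abs_inv_half_le_crude {a : ℝ} (ha : 0 < a) : |a⁻¹ / 2| ≤ 2 * a + a⁻¹ := by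
  have hi := inv_pos.2 ha
  rw [abs_of_pos (by positivity)]; linarith

/-- the crude bound: `|a⁻¹·s∕2| ≤ 2a + a⁻¹` for `a > 0`, `|s| = 1`. [folklore] -/
theorem abs_inv_sign_half_le_crude {a s : ℝ} (ha : 0 < a) (hs : |s| = 1) : |a⁻¹ * s / 2| ≤ 2 * a + a⁻¹ := by
  rw [show a⁻¹ * s / 2 = s * (a⁻¹ / 2) by ring, abs_mul, hs, one_mul]; exact abs_inv_half_le_crude ha

/-- the crude bound for the index frame `A = 2·I·s·a`: `‖2·(I·(s a))‖ = 2a ≤ 2a + a⁻¹`. [folklore] -/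
theorem norm_two_mul_I_mul_le_crude {a s : ℝ} (ha : 0 < a) (hs : |s| = 1) : ‖(2 : ℂ) * (I * ((s * a : ℝ) : ℂ))‖ ≤ 2 * a + a⁻¹ := by
  rw [norm_mul, norm_mul, Complex.norm_I, one_mul, Complex.norm_real, Real.norm_eq_abs, abs_mul, hs, one_mul, abs_of_pos ha, Complex.norm_two]
  have := inv_pos.2 ha; linarith

/-- the crude bound for the inverse index frame: `‖(2·(I·(s a)))⁻¹‖ = (2a)⁻¹ ≤ 2a + a⁻¹`. [folklore] -/
theorem norm_inv_two_mul_I_mul_le_crude {a s : ℝ} (ha : 0 < a) (hs : |s| = 1) : ‖((2 : ℂ) * (I * ((s * a : ℝ) : ℂ)))⁻¹‖ ≤ 2 * a + a⁻¹ := by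
  rw [norm_inv, norm_mul, norm_mul, Complex.norm_I, one_mul, Complex.norm_real, Real.norm_eq_abs, abs_mul, hs, one_mul, abs_of_pos ha, Complex.norm_two]
  have hi := inv_pos.2 ha
  have h2 : (2 * a)⁻¹ ≤ a⁻¹ := by rw [mul_inv, ← one_mul a⁻¹, ← mul_assoc]; exact mul_le_mul_of_nonneg_right (by norm_num) hi.le
  linarith

/-- the crude bound for the inverse of `B = a⁻¹∕2`: `‖((a⁻¹∕2 : ℝ) : ℂ)⁻¹‖ = 2a ≤ 2a + a⁻¹`. [folklore] -/
theorem norm_inv_ofReal_inv_half_le_crude {a : ℝ} (ha : 0 < a) : ‖(((a⁻¹ / 2 : ℝ) : ℂ))⁻¹‖ ≤ 2 * a + a⁻¹ := by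
  rw [norm_inv, Complex.norm_real, Real.norm_eq_abs, abs_of_pos (by positivity), inv_div, div_eq_mul_inv, inv_inv]
  have := inv_pos.2 ha; linarith

/-! ## §2 The size-frame letters at the frames of record -/

variable (L : Type) [Field L] [NumberField L] [IsCMField L]
variable {N₀ M₀ : ℕ} (e : Fin N₀ × Fin M₀ ≃ Fin 2)
  (dV : Fin N₀ → L) (hdV : ∀ i, IsCMField.complexConj L (dV i) = dV i)
  (dW : Fin M₀ → L) (hdW : ∀ i, IsCMField.complexConj L (dW i) = dW i)

include hdV hdW in
/-- **THE 26 (iii-arch) SIZE-FRAME LETTERS OF THE KW HEAD OF RECORD, AT THE FRAMES OF RECORD.**  Inputs: `dV dW ≠ 0` and archimedean frames `T Tinv` GIVEN BY ★ arch₄'s closed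
forms (`hTdef hTinvdef` — the bytes ★ p863672 ∕ ★ p863767 `exists_frames_hex_of_std(')` export).  Output, at `Sinf := {w // w.IsComplex}`, `φ σ := σ.1.embedding`, `w := id`,
`er := e₂ (n := 2)`: index frames `A σ = (-2 : ℂ) • (T σ).toBlocks₂₂`, `B σ = (Tinv σ).toBlocks₁₁` (so `A σ · S^{φ σ} · B σ` is K2Liu-p11's framed index `HIDX S σ`) with diagonal
inverses `Ainv Binv`, ONE common bound `Mf` for the entries of `A B Ainv Binv` and ONE common bound `M` for the entries of `T Tinv` (both `= 1 + Σ_{σ,k} (2a_{σk} + a_{σk}⁻¹)`),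
the one-sided inverse letters `Ainv σ * A σ = 1`, `B σ * Binv σ = 1`, the covering letter `hcover` (a CM field is totally complex), the conjugation letter `hw`, and
`T σ * Tinv σ = 1` (★ arch₄) — every conjunct in the binder bytes of ★ `kindW_block_cm_of_localLetters_haar` :163–169 at `n := 2`.
[cite: Shimura1997, §16.4, §18.1 (18.4)] [cite: BorelJacquet1979, §1.2, §4.1] -/
theorem archSizeFrames_of_closedForm (hdV0 : ∀ i, dV i ≠ 0) (hdW0 : ∀ i, dW i ≠ 0)
    (T Tinv : {w : InfinitePlace L // w.IsComplex} → Matrix (Fin 2 ⊕ Fin 2) (Fin 2 ⊕ Fin 2) ℂ)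
    (hTdef : ∀ w, T w = fromBlocks (diagonal (fun k => (Real.sqrt (|(w.1.embedding (dV (e.symm k).1 * dW (e.symm k).2)).re| / 2) : ℂ))) (diagonal (fun k => (Real.sqrt (|(w.1.embedding (dV (e.symm k).1 * dW (e.symm k).2)).re| / 2) : ℂ)))
            (diagonal (fun k => I * ((((w.1.embedding (dV (e.symm k).1 * dW (e.symm k).2)).re / |(w.1.embedding (dV (e.symm k).1 * dW (e.symm k).2)).re|) * Real.sqrt (|(w.1.embedding (dV (e.symm k).1 * dW (e.symm k).2)).re| / 2) : ℝ) : ℂ))) (-diagonal (fun k => I * ((((w.1.embedding (dV (e.symm k).1 * dW (e.symm k).2)).re / |(w.1.embedding (dV (e.symm k).1 * dW (e.symm k).2)).re|) * Real.sqrt (|(w.1.embedding (dV (e.symm k).1 * dW (e.symm k).2)).re| / 2) : ℝ) : ℂ))))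
    (hTinvdef : ∀ w, Tinv w = fromBlocks (diagonal (fun k => (((Real.sqrt (|(w.1.embedding (dV (e.symm k).1 * dW (e.symm k).2)).re| / 2))⁻¹ / 2 : ℝ) : ℂ))) (-diagonal (fun k => I * (((Real.sqrt (|(w.1.embedding (dV (e.symm k).1 * dW (e.symm k).2)).re| / 2))⁻¹ * ((w.1.embedding (dV (e.symm k).1 * dW (e.symm k).2)).re / |(w.1.embedding (dV (e.symm k).1 * dW (e.symm k).2)).re|) / 2 : ℝ) : ℂ)))
            (diagonal (fun k => (((Real.sqrt (|(w.1.embedding (dV (e.symm k).1 * dW (e.symm k).2)).re| / 2))⁻¹ / 2 : ℝ) : ℂ))) (diagonal (fun k => I * (((Real.sqrt (|(w.1.embedding (dV (e.symm k).1 * dW (e.symm k).2)).re| / 2))⁻¹ * ((w.1.embedding (dV (e.symm k).1 * dW (e.symm k).2)).re / |(w.1.embedding (dV (e.symm k).1 * dW (e.symm k).2)).re|) / 2 : ℝ) : ℂ)))) :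
    ∃ (A B Ainv Binv : {w : InfinitePlace L // w.IsComplex} → Matrix (Fin 2) (Fin 2) ℂ) (Mf M : ℝ),
      (∀ σ, A σ = (-2 : ℂ) • (T σ).toBlocks₂₂) ∧ (∀ σ, B σ = (Tinv σ).toBlocks₁₁) ∧
      1 ≤ Mf ∧ (∀ σ (i j : Fin 2), ‖A σ i j‖ ≤ Mf) ∧ (∀ σ (i j : Fin 2), ‖B σ i j‖ ≤ Mf) ∧
      (∀ σ (i j : Fin 2), ‖Ainv σ i j‖ ≤ Mf) ∧ (∀ σ (i j : Fin 2), ‖Binv σ i j‖ ≤ Mf) ∧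
      (∀ σ, Ainv σ * A σ = 1) ∧ (∀ σ, B σ * Binv σ = 1) ∧
      (∀ w : InfinitePlace L, ∃ σ : {w : InfinitePlace L // w.IsComplex}, InfinitePlace.mk σ.1.embedding = w) ∧
      (∀ σ : {w : InfinitePlace L // w.IsComplex}, (IsCMField.complexConj L : L ≃ₐ[Fp L] L) • σ.1 = σ.1) ∧
      (∀ σ, T σ * Tinv σ = 1) ∧
      1 ≤ M ∧ (∀ σ (i j : Fin 2 ⊕ Fin 2), ‖T σ i j‖ ≤ M) ∧ (∀ σ (i j : Fin 2 ⊕ Fin 2), ‖Tinv σ i j‖ ≤ M) := by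
  -- `T σ * Tinv σ = 1`: ★ arch₄ produces frames with the SAME closed forms
  have hT1 : ∀ σ, T σ * Tinv σ = 1 := fun σ => by
    obtain ⟨T', Ti', h1, -, -, -, -, -, -, -, hT', hTi'⟩ :=
      exists_tubeFrame_arch₄ L e dV hdV dW hdW σ (UnitaryGroup.complexConj_smul_infinitePlace L σ.1) hdV0 hdW0
    rw [hTdef σ, hTinvdef σ, ← hT', ← hTi']; exact h1
  -- the numbers of the closed forms: `c_{σk} = re ι_σ(dV·dW)_k ≠ 0`, `a_{σk} = √(|c|∕2) > 0`, `s_{σk} = c∕|c|`, `|s| = 1`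
  obtain ⟨a, ha⟩ : ∃ a : {w : InfinitePlace L // w.IsComplex} → Fin 2 → ℝ,
      ∀ w k, a w k = Real.sqrt (|(w.1.embedding (dV (e.symm k).1 * dW (e.symm k).2)).re| / 2) := ⟨_, fun _ _ => rfl⟩
  obtain ⟨sg, hsg⟩ : ∃ sg : {w : InfinitePlace L // w.IsComplex} → Fin 2 → ℝ,
      ∀ w k, sg w k = (w.1.embedding (dV (e.symm k).1 * dW (e.symm k).2)).re / |(w.1.embedding (dV (e.symm k).1 * dW (e.symm k).2)).re| := ⟨_, fun _ _ => rfl⟩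
  have hc0 : ∀ (w : {w : InfinitePlace L // w.IsComplex}) (k : Fin 2), (w.1.embedding (dV (e.symm k).1 * dW (e.symm k).2)).re ≠ 0 := fun w k =>
    tw_ne_zero L e dV hdV dW hdW w (UnitaryGroup.complexConj_smul_infinitePlace L w.1) hdV0 hdW0 k
  have ha0 : ∀ w k, 0 < a w k := fun w k => by rw [ha]; exact Real.sqrt_pos.2 (div_pos (abs_pos.2 (hc0 w k)) two_pos)
  have hsg1 : ∀ w k, |sg w k| = 1 := fun w k => by rw [hsg, abs_div, abs_abs, div_self (abs_ne_zero.2 (hc0 w k))]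
  have hsg0 : ∀ w k, sg w k ≠ 0 := fun w k h => by have := hsg1 w k; rw [h, abs_zero] at this; exact zero_ne_one this
  simp only [← ha, ← hsg] at hTdef hTinvdef
  -- the one crude bound
  obtain ⟨M, hM⟩ : ∃ M : ℝ, M = 1 + ∑ σ, ∑ k, (2 * a σ k + (a σ k)⁻¹) := ⟨_, rfl⟩
  have hterm0 : ∀ σ k, 0 ≤ 2 * a σ k + (a σ k)⁻¹ := fun σ k => by have := ha0 σ k; have := inv_pos.2 (ha0 σ k); positivity
  have hbd : ∀ σ k, 2 * a σ k + (a σ k)⁻¹ ≤ M := fun σ k => by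
    have h1 : 2 * a σ k + (a σ k)⁻¹ ≤ ∑ k', (2 * a σ k' + (a σ k')⁻¹) :=
      Finset.single_le_sum (f := fun k' => 2 * a σ k' + (a σ k')⁻¹) (fun k' _ => hterm0 σ k') (Finset.mem_univ k)
    have h2 : ∑ k', (2 * a σ k' + (a σ k')⁻¹) ≤ ∑ σ', ∑ k', (2 * a σ' k' + (a σ' k')⁻¹) :=
      Finset.single_le_sum (f := fun σ' => ∑ k', (2 * a σ' k' + (a σ' k')⁻¹)) (fun σ' _ => Finset.sum_nonneg fun k' _ => hterm0 σ' k') (Finset.mem_univ σ)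
    rw [hM]; linarith
  have hM0 : 0 ≤ M := by rw [hM]; have := Finset.sum_nonneg fun σ' (_ : σ' ∈ Finset.univ) => Finset.sum_nonneg fun k' (_ : k' ∈ Finset.univ) => hterm0 σ' k'; linarith
  have hM1 : 1 ≤ M := by rw [hM]; have := Finset.sum_nonneg fun σ' (_ : σ' ∈ Finset.univ) => Finset.sum_nonneg fun k' (_ : k' ∈ Finset.univ) => hterm0 σ' k'; linarith
  -- the index frames as diagonals
  have hAd : ∀ σ, (-2 : ℂ) • (T σ).toBlocks₂₂ = diagonal fun k => (2 : ℂ) * (I * ((sg σ k * a σ k : ℝ) : ℂ)) := fun σ => by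
    rw [hTdef σ, toBlocks_fromBlocks₂₂]
    ext i j
    simp only [Matrix.smul_apply, Matrix.neg_apply, diagonal_apply, smul_eq_mul]
    split_ifs <;> ring
  have hBd : ∀ σ, (Tinv σ).toBlocks₁₁ = diagonal fun k => (((a σ k)⁻¹ / 2 : ℝ) : ℂ) := fun σ => by
    rw [hTinvdef σ, toBlocks_fromBlocks₁₁]
  have hAne : ∀ σ k, (2 : ℂ) * (I * ((sg σ k * a σ k : ℝ) : ℂ)) ≠ 0 := fun σ k =>
    mul_ne_zero two_ne_zero (mul_ne_zero I_ne_zero (ofReal_ne_zero.2 (mul_ne_zero (hsg0 σ k) (ha0 σ k).ne')))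
  have hBne : ∀ σ k, (((a σ k)⁻¹ / 2 : ℝ) : ℂ) ≠ 0 := fun σ k =>
    ofReal_ne_zero.2 (div_ne_zero (inv_ne_zero (ha0 σ k).ne') two_ne_zero)
  refine ⟨fun σ => (-2 : ℂ) • (T σ).toBlocks₂₂, fun σ => (Tinv σ).toBlocks₁₁,
    fun σ => diagonal fun k => ((2 : ℂ) * (I * ((sg σ k * a σ k : ℝ) : ℂ)))⁻¹, fun σ => diagonal fun k => ((((a σ k)⁻¹ / 2 : ℝ) : ℂ))⁻¹,
    M, M, fun σ => rfl, fun σ => rfl, hM1, ?_, ?_, ?_, ?_, ?_, ?_, ?_, ?_, hT1, hM1, ?_, ?_⟩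
  · intro σ i j; dsimp only; rw [hAd σ]
    exact norm_diagonal_apply_le hM0 (fun k => (norm_two_mul_I_mul_le_crude (ha0 σ k) (hsg1 σ k)).trans (hbd σ k)) i j
  · intro σ i j; dsimp only; rw [hBd σ]
    exact norm_diagonal_apply_le hM0 (fun k => (norm_ofReal_le_of_abs_le (abs_inv_half_le_crude (ha0 σ k))).trans (hbd σ k)) i j
  · intro σ i j; dsimp only
    exact norm_diagonal_apply_le hM0 (fun k => (norm_inv_two_mul_I_mul_le_crude (ha0 σ k) (hsg1 σ k)).trans (hbd σ k)) i j
  · intro σ i j; dsimp only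
    exact norm_diagonal_apply_le hM0 (fun k => (norm_inv_ofReal_inv_half_le_crude (ha0 σ k)).trans (hbd σ k)) i j
  · intro σ; dsimp only; rw [hAd σ, diagonal_mul_diagonal, ← diagonal_one]
    exact congrArg diagonal (funext fun k => inv_mul_cancel₀ (hAne σ k))
  · intro σ; dsimp only
    rw [hBd σ, diagonal_mul_diagonal, ← diagonal_one]
    exact congrArg diagonal (funext fun k => mul_inv_cancel₀ (hBne σ k))
  · intro w; exact ⟨⟨w, IsTotallyComplex.isComplex w⟩, InfinitePlace.mk_embedding w⟩
  · intro σ; exact UnitaryGroup.complexConj_smul_infinitePlace L σ.1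
  · intro σ i j; rw [hTdef σ, diagonal_neg]
    exact norm_fromBlocks_diagonal_apply_le hM0
      (fun k => (norm_ofReal_le_of_abs_le (abs_le_crude (ha0 σ k))).trans (hbd σ k))
      (fun k => (norm_ofReal_le_of_abs_le (abs_le_crude (ha0 σ k))).trans (hbd σ k))
      (fun k => (norm_I_mul_ofReal_le_of_abs_le (abs_sign_mul_le_crude (ha0 σ k) (hsg1 σ k))).trans (hbd σ k))
      (fun k => by rw [norm_neg]; exact (norm_I_mul_ofReal_le_of_abs_le (abs_sign_mul_le_crude (ha0 σ k) (hsg1 σ k))).trans (hbd σ k)) i j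
  · intro σ i j; rw [hTinvdef σ, diagonal_neg]
    exact norm_fromBlocks_diagonal_apply_le hM0
      (fun k => (norm_ofReal_le_of_abs_le (abs_inv_half_le_crude (ha0 σ k))).trans (hbd σ k))
      (fun k => by rw [norm_neg]; exact (norm_I_mul_ofReal_le_of_abs_le (abs_inv_sign_half_le_crude (ha0 σ k) (hsg1 σ k))).trans (hbd σ k))
      (fun k => (norm_ofReal_le_of_abs_le (abs_inv_half_le_crude (ha0 σ k))).trans (hbd σ k))
      (fun k => (norm_I_mul_ofReal_le_of_abs_le (abs_inv_sign_half_le_crude (ha0 σ k) (hsg1 σ k))).trans (hbd σ k)) i j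

/-! ## §3 (ED. 2) The ∃-form: frames produced inside (★ arch₄), closed forms exported -/

include hdV hdW in
/-- **THE (iii-arch) SIZE FRAMES OF RECORD, ∃-FORM.**  `dV dW ≠ 0` ⊢ there exist archimedean frames `T Tinv` WITH ★ arch₄'s closed forms (`hTdef hTinvdef`, the bytes ★ p863672 ∕ ★ p863767
export — so any two frame families of record agree by rewriting) and the index frames `A B Ainv Binv` with the bounds `Mf M` and every letter of §2 `archSizeFrames_of_closedForm`.
For a tie that does not want to thread the (x-a) column's frames into the (iii-arch) block.  Proof: `choose` on ★ arch₄, then §2.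
[cite: Shimura1997, §16.4, §18.1 (18.4)] [cite: BorelJacquet1979, §1.2, §4.1] -/
theorem exists_archSizeFrames_of_record (hdV0 : ∀ i, dV i ≠ 0) (hdW0 : ∀ i, dW i ≠ 0) :
    ∃ (T Tinv : {w : InfinitePlace L // w.IsComplex} → Matrix (Fin 2 ⊕ Fin 2) (Fin 2 ⊕ Fin 2) ℂ)
      (A B Ainv Binv : {w : InfinitePlace L // w.IsComplex} → Matrix (Fin 2) (Fin 2) ℂ) (Mf M : ℝ),
      (∀ w, T w = fromBlocks (diagonal (fun k => (Real.sqrt (|(w.1.embedding (dV (e.symm k).1 * dW (e.symm k).2)).re| / 2) : ℂ))) (diagonal (fun k => (Real.sqrt (|(w.1.embedding (dV (e.symm k).1 * dW (e.symm k).2)).re| / 2) : ℂ)))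
          (diagonal (fun k => I * ((((w.1.embedding (dV (e.symm k).1 * dW (e.symm k).2)).re / |(w.1.embedding (dV (e.symm k).1 * dW (e.symm k).2)).re|) * Real.sqrt (|(w.1.embedding (dV (e.symm k).1 * dW (e.symm k).2)).re| / 2) : ℝ) : ℂ))) (-diagonal (fun k => I * ((((w.1.embedding (dV (e.symm k).1 * dW (e.symm k).2)).re / |(w.1.embedding (dV (e.symm k).1 * dW (e.symm k).2)).re|) * Real.sqrt (|(w.1.embedding (dV (e.symm k).1 * dW (e.symm k).2)).re| / 2) : ℝ) : ℂ)))) ∧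
      (∀ w, Tinv w = fromBlocks (diagonal (fun k => (((Real.sqrt (|(w.1.embedding (dV (e.symm k).1 * dW (e.symm k).2)).re| / 2))⁻¹ / 2 : ℝ) : ℂ))) (-diagonal (fun k => I * (((Real.sqrt (|(w.1.embedding (dV (e.symm k).1 * dW (e.symm k).2)).re| / 2))⁻¹ * ((w.1.embedding (dV (e.symm k).1 * dW (e.symm k).2)).re / |(w.1.embedding (dV (e.symm k).1 * dW (e.symm k).2)).re|) / 2 : ℝ) : ℂ)))
          (diagonal (fun k => (((Real.sqrt (|(w.1.embedding (dV (e.symm k).1 * dW (e.symm k).2)).re| / 2))⁻¹ / 2 : ℝ) : ℂ))) (diagonal (fun k => I * (((Real.sqrt (|(w.1.embedding (dV (e.symm k).1 * dW (e.symm k).2)).re| / 2))⁻¹ * ((w.1.embedding (dV (e.symm k).1 * dW (e.symm k).2)).re / |(w.1.embedding (dV (e.symm k).1 * dW (e.symm k).2)).re|) / 2 : ℝ) : ℂ)))) ∧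
      (∀ σ, A σ = (-2 : ℂ) • (T σ).toBlocks₂₂) ∧ (∀ σ, B σ = (Tinv σ).toBlocks₁₁) ∧
      1 ≤ Mf ∧ (∀ σ (i j : Fin 2), ‖A σ i j‖ ≤ Mf) ∧ (∀ σ (i j : Fin 2), ‖B σ i j‖ ≤ Mf) ∧
      (∀ σ (i j : Fin 2), ‖Ainv σ i j‖ ≤ Mf) ∧ (∀ σ (i j : Fin 2), ‖Binv σ i j‖ ≤ Mf) ∧
      (∀ σ, Ainv σ * A σ = 1) ∧ (∀ σ, B σ * Binv σ = 1) ∧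
      (∀ w : InfinitePlace L, ∃ σ : {w : InfinitePlace L // w.IsComplex}, InfinitePlace.mk σ.1.embedding = w) ∧
      (∀ σ : {w : InfinitePlace L // w.IsComplex}, (IsCMField.complexConj L : L ≃ₐ[Fp L] L) • σ.1 = σ.1) ∧
      (∀ σ, T σ * Tinv σ = 1) ∧
      1 ≤ M ∧ (∀ σ (i j : Fin 2 ⊕ Fin 2), ‖T σ i j‖ ≤ M) ∧ (∀ σ (i j : Fin 2 ⊕ Fin 2), ‖Tinv σ i j‖ ≤ M) := by
  choose T Tinv h1 h2 hTU hTS hTiv hTN hTV hW hTdef hTinvdef using fun w : {w : InfinitePlace L // w.IsComplex} =>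
    exists_tubeFrame_arch₄ L e dV hdV dW hdW w (UnitaryGroup.complexConj_smul_infinitePlace L w.1) hdV0 hdW0
  obtain ⟨A, B, Ainv, Binv, Mf, M, hrest⟩ := archSizeFrames_of_closedForm L e dV hdV dW hdW hdV0 hdW0 T Tinv hTdef hTinvdef
  exact ⟨T, Tinv, A, B, Ainv, Binv, Mf, M, hTdef, hTinvdef, hrest⟩

end Summit.HodgeConjecture.HodgeConjecture.Cruxes.HLiu418.K2LiuKindWArchSizeFramesOfRecord

end
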